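import Summits.CriticalPhenomena.SAWScalingLimit.Theorems.SAWDefectDecoherenceBoundaryClosureRInnerPolygonsMarks
import Literature.Probability.RandomPlanarGeometry.RectangleConformalMap
import Literature.Probability.RandomPlanarGeometry.PolygonalDomains
import HarnessLib

/-!
# Negative knowledge on crux `OneSidedPowerLaw` (stmt-CriticalPhenomena-10702), part 1: the pentagon witnesses
(one-sided hull subdomains of the square `(-2,2)²` marked at `2`, `-2`: the square minus the closed triangle
`{ε·y ≥ -1/2 + (5/4)|x|}`, hanging from the top side for `ε = 1` and from the bottom side for `ε = -1`).

Both pentagons are treated at once with a sign parameter `ε` (`ε = 1 ∨ ε = -1`). The vertex list is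
`(-2,-2ε), (2,-2ε), (2,2ε), (0,-ε/2), (-2,2ε)`; the open pentagon is
`{z ∈ (-2,2)² | ε·im z < -1/2 + (5/4)|re z|}` (the "roof" is `x ↦ -1/2 + (5/4)|x|`). We prove that
the polygon is simple, identify the inside of the polygon with the open pentagon
(`polygonDomain_carrier_eq`), mark it at `2` and `-2` (`exists_pentDomain`), and record the
closure / separation facts used by part 2. Everything is stated with the sets written out:
no definition and no named fact is introduced.
-/

noncomputable section

open Set Complex Metric
open Literature.Probability.RandomPlanarGeometry

namespace Summit.CriticalPhenomena.SAWScalingLimit.Theorems.OneSidedPowerLaw.Negative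

/-! ### The polygon is simple -/

/-- **The pentagon is a simple closed polygon.** Every pair of distinct half-open edges is
separated by a linear fact (a different constant coordinate, or a strict inequality coming from
the half-open parameter). -/
theorem isSimpleClosedPolygon_pentVerts {ε : ℝ} (hε : ε = 1 ∨ ε = -1) :
    IsSimpleClosedPolygon ([⟨-2, -2 * ε⟩, ⟨2, -2 * ε⟩, ⟨2, 2 * ε⟩, ⟨0, -ε / 2⟩, ⟨-2, 2 * ε⟩] : List ℂ) := by
  rcases hε with rfl | rfl
  all_goals
    refine IsSimpleClosedPolygon.of_lt (by simp) ?_ ?_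
    · intro k hk
      have : k < 5 := by simpa using hk
      interval_cases k <;> norm_num [Complex.ext_iff]
    · intro i j hi hj hij
      have hj5 : j < 5 := by simpa using hj
      interval_cases j <;> interval_cases i <;>
      · simp only [List.length_cons, List.length_nil, Nat.reduceAdd, Nat.reduceMod,
          List.getElem_cons_zero, List.getElem_cons_succ, Set.disjoint_left]
        rintro _ ⟨θ, ⟨hθ0, hθ1⟩, rfl⟩ ⟨θ', ⟨hθ0', hθ1'⟩, h⟩
        have hre := congrArg Complex.re h
        have him := congrArg Complex.im h
        simp [AffineMap.lineMap_apply_module'] at hre him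
        linarith

/-! ### The open pentagon -/

/-- The pentagon lies in the square. -/
theorem pentSet_subset (ε : ℝ) : {z : ℂ | z ∈ symRect 2 2 ∧ ε * z.im < -1 / 2 + 5 / 4 * |z.re|} ⊆ symRect 2 2 :=
  fun _ hz => hz.1

/-- The roof `z ↦ -1/2 + (5/4)|re z|` is continuous. -/
theorem continuous_roof : Continuous fun z : ℂ => -1 / 2 + 5 / 4 * |z.re| :=
  continuous_const.add (continuous_const.mul (continuous_abs.comp continuous_re))

/-- The pentagon is open. -/
theorem isOpen_pentSet (ε : ℝ) : IsOpen {z : ℂ | z ∈ symRect 2 2 ∧ ε * z.im < -1 / 2 + 5 / 4 * |z.re|} :=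
  (isOpen_symRect 2 2).inter (isOpen_lt (continuous_const.mul continuous_im) continuous_roof)

/-- The pentagon is nonempty: it contains `(0, -ε)`. -/
theorem pentSet_nonempty {ε : ℝ} (hε : ε = 1 ∨ ε = -1) : ({z : ℂ | z ∈ symRect 2 2 ∧ ε * z.im < -1 / 2 + 5 / 4 * |z.re|}).Nonempty :=
  ⟨⟨0, -ε⟩, by rcases hε with rfl | rfl <;> norm_num [mem_symRect]⟩

/-- The closed pentagon lies in the closed square, weakly below / above the roof (any `ε`). -/
theorem closure_pentSet_subset' (ε : ℝ) : closure {z : ℂ | z ∈ symRect 2 2 ∧ ε * z.im < -1 / 2 + 5 / 4 * |z.re|} ⊆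
    {z : ℂ | z ∈ closure (symRect 2 2) ∧ ε * z.im ≤ -1 / 2 + 5 / 4 * |z.re|} :=
  closure_minimal (fun _ hz => ⟨subset_closure hz.1, hz.2.le⟩)
    (isClosed_closure.inter (isClosed_le (continuous_const.mul continuous_im) continuous_roof))

/-- The closed pentagon lies in the closed square, weakly below / above the roof. -/
theorem closure_pentSet_subset {ε : ℝ} (hε : ε = 1 ∨ ε = -1) : closure {z : ℂ | z ∈ symRect 2 2 ∧ ε * z.im < -1 / 2 + 5 / 4 * |z.re|} ⊆
    {z : ℂ | z ∈ closure (symRect 2 2) ∧ ε * z.im ≤ -1 / 2 + 5 / 4 * |z.re|} :=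
  hε.elim (fun _ => closure_pentSet_subset' ε) fun _ => closure_pentSet_subset' ε

/-! ### Points of the polygon -/

/-- A point `lineMap v_k v_{k+1} θ`, `θ ∈ [0, 1]`, of an edge of a closed polygon lies on it. -/
theorem mem_range_of_lineMap_eq {l : List ℂ} {z : ℂ} (k : ℕ) (hk : k < l.length) (θ : ℝ)
    (h0 : 0 ≤ θ) (h1 : θ ≤ 1)
    (hz : AffineMap.lineMap l[k] (l[(k + 1) % l.length]'(Nat.mod_lt _ (by omega))) θ = z) :
    z ∈ range (polygonLoop l) :=
  ⟨_, (polygonLoop_apply_div hk ⟨h0, h1⟩).trans hz⟩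

/-- Points of the bottom side `im = -2ε` lie on the polygon (edge `0`). -/
theorem mem_range_of_im_eq {ε : ℝ} {z : ℂ} (h : z.im = -2 * ε) (h1 : -2 ≤ z.re)
    (h2 : z.re ≤ 2) : z ∈ range (polygonLoop ([⟨-2, -2 * ε⟩, ⟨2, -2 * ε⟩, ⟨2, 2 * ε⟩, ⟨0, -ε / 2⟩, ⟨-2, 2 * ε⟩] : List ℂ)) :=
  mem_range_of_lineMap_eq 0 (by norm_num) ((z.re + 2) / 4) (by linarith) (by linarith)
    (by apply Complex.ext <;> simp [AffineMap.lineMap_apply_module'] <;> linarith)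

/-- Points of the right side `re = 2` lie on the polygon (edge `1`). -/
theorem mem_range_of_re_eq_two {ε : ℝ} (hε : ε = 1 ∨ ε = -1) {z : ℂ} (h : z.re = 2)
    (h1 : -2 ≤ z.im) (h2 : z.im ≤ 2) : z ∈ range (polygonLoop ([⟨-2, -2 * ε⟩, ⟨2, -2 * ε⟩, ⟨2, 2 * ε⟩, ⟨0, -ε / 2⟩, ⟨-2, 2 * ε⟩] : List ℂ)) := by
  rcases hε with rfl | rfl
  · exact mem_range_of_lineMap_eq 1 (by norm_num) ((z.im + 2) / 4) (by linarith) (by linarith)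
      (by apply Complex.ext <;> simp [AffineMap.lineMap_apply_module'] <;> linarith)
  · exact mem_range_of_lineMap_eq 1 (by norm_num) ((2 - z.im) / 4) (by linarith) (by linarith)
      (by apply Complex.ext <;> simp [AffineMap.lineMap_apply_module'] <;> linarith)

/-- Points of the slanted edge over `[0, 2]` (`ε im = -1/2 + (5/4) re`) lie on the polygon
(edge `2`). -/
theorem mem_range_of_roof_right {ε : ℝ} (hε : ε = 1 ∨ ε = -1) {z : ℂ} (h0 : 0 ≤ z.re)
    (h2 : z.re ≤ 2) (h : ε * z.im = -1 / 2 + 5 / 4 * z.re) :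
    z ∈ range (polygonLoop ([⟨-2, -2 * ε⟩, ⟨2, -2 * ε⟩, ⟨2, 2 * ε⟩, ⟨0, -ε / 2⟩, ⟨-2, 2 * ε⟩] : List ℂ)) :=
  mem_range_of_lineMap_eq 2 (by norm_num) ((2 - z.re) / 2) (by linarith) (by linarith)
    (by rcases hε with rfl | rfl <;> apply Complex.ext <;>
          simp [AffineMap.lineMap_apply_module'] <;> linarith)

/-- Points of the slanted edge over `[-2, 0]` (`ε im = -1/2 - (5/4) re`) lie on the polygon
(edge `3`). -/
theorem mem_range_of_roof_left {ε : ℝ} (hε : ε = 1 ∨ ε = -1) {z : ℂ} (h1 : -2 ≤ z.re)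
    (h0 : z.re ≤ 0) (h : ε * z.im = -1 / 2 - 5 / 4 * z.re) :
    z ∈ range (polygonLoop ([⟨-2, -2 * ε⟩, ⟨2, -2 * ε⟩, ⟨2, 2 * ε⟩, ⟨0, -ε / 2⟩, ⟨-2, 2 * ε⟩] : List ℂ)) :=
  mem_range_of_lineMap_eq 3 (by norm_num) (-z.re / 2) (by linarith) (by linarith)
    (by rcases hε with rfl | rfl <;> apply Complex.ext <;>
          simp [AffineMap.lineMap_apply_module'] <;> linarith)

/-- Points of the left side `re = -2` lie on the polygon (edge `4`). -/
theorem mem_range_of_re_eq_neg_two {ε : ℝ} (hε : ε = 1 ∨ ε = -1) {z : ℂ} (h : z.re = -2)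
    (h1 : -2 ≤ z.im) (h2 : z.im ≤ 2) : z ∈ range (polygonLoop ([⟨-2, -2 * ε⟩, ⟨2, -2 * ε⟩, ⟨2, 2 * ε⟩, ⟨0, -ε / 2⟩, ⟨-2, 2 * ε⟩] : List ℂ)) := by
  rcases hε with rfl | rfl
  · exact mem_range_of_lineMap_eq 4 (by norm_num) ((2 - z.im) / 4) (by linarith) (by linarith)
      (by apply Complex.ext <;> simp [AffineMap.lineMap_apply_module'] <;> linarith)
  · exact mem_range_of_lineMap_eq 4 (by norm_num) ((z.im + 2) / 4) (by linarith) (by linarith)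
      (by apply Complex.ext <;> simp [AffineMap.lineMap_apply_module'] <;> linarith)

/-- `2` lies on the polygon (midpoint of the right side). -/
theorem two_mem_range {ε : ℝ} (hε : ε = 1 ∨ ε = -1) :
    (2 : ℂ) ∈ range (polygonLoop ([⟨-2, -2 * ε⟩, ⟨2, -2 * ε⟩, ⟨2, 2 * ε⟩, ⟨0, -ε / 2⟩, ⟨-2, 2 * ε⟩] : List ℂ)) :=
  mem_range_of_re_eq_two hε (by norm_num) (by norm_num) (by norm_num)

/-- `-2` lies on the polygon (midpoint of the left side). -/
theorem neg_two_mem_range {ε : ℝ} (hε : ε = 1 ∨ ε = -1) :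
    (-2 : ℂ) ∈ range (polygonLoop ([⟨-2, -2 * ε⟩, ⟨2, -2 * ε⟩, ⟨2, 2 * ε⟩, ⟨0, -ε / 2⟩, ⟨-2, 2 * ε⟩] : List ℂ)) :=
  mem_range_of_re_eq_neg_two hε (by norm_num) (by norm_num) (by norm_num)

/-- **The polygon misses the open pentagon**: the sides of the square are off the open square, and
on the slanted edges `ε im = -1/2 + (5/4)|re|` exactly. -/
theorem notMem_pentSet_of_mem_range {ε : ℝ} (hε : ε = 1 ∨ ε = -1) {z : ℂ}
    (hz : z ∈ range (polygonLoop ([⟨-2, -2 * ε⟩, ⟨2, -2 * ε⟩, ⟨2, 2 * ε⟩, ⟨0, -ε / 2⟩, ⟨-2, 2 * ε⟩] : List ℂ))) : z ∉ {z : ℂ | z ∈ symRect 2 2 ∧ ε * z.im < -1 / 2 + 5 / 4 * |z.re|} := by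
  rintro ⟨hzR, hlt⟩
  obtain ⟨⟨hr1, hr2⟩, hi1, hi2⟩ := mem_symRect.1 hzR
  rw [range_polygonLoop (List.cons_ne_nil _ _)] at hz
  simp only [mem_iUnion, segment_eq_image_lineMap, mem_image] at hz
  obtain ⟨⟨k, hk⟩, θ, ⟨hθ0, hθ1⟩, hzθ⟩ := hz
  have hk5 : k < 5 := by simpa using hk
  have hre := congrArg Complex.re hzθ
  have him := congrArg Complex.im hzθ
  rcases le_total 0 z.re with h0 | h0
  · have hr := abs_of_nonneg h0
    rcases hε with rfl | rfl <;> interval_cases k <;>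
      simp [AffineMap.lineMap_apply_module'] at hre him <;> linarith
  · have hr := abs_of_nonpos h0
    rcases hε with rfl | rfl <;> interval_cases k <;>
      simp [AffineMap.lineMap_apply_module'] at hre him <;> linarith

/-- **The frontier of the open pentagon lies on the polygon.** A point of the closed pentagon off
the open one is on a side of the square (the roof inequality picking the right one) or on the
graph of the roof inside the square. -/
theorem frontier_pentSet_subset {ε : ℝ} (hε : ε = 1 ∨ ε = -1) :
    frontier {z : ℂ | z ∈ symRect 2 2 ∧ ε * z.im < -1 / 2 + 5 / 4 * |z.re|} ⊆ range (polygonLoop ([⟨-2, -2 * ε⟩, ⟨2, -2 * ε⟩, ⟨2, 2 * ε⟩, ⟨0, -ε / 2⟩, ⟨-2, 2 * ε⟩] : List ℂ)) := by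
  intro z hz
  rw [(isOpen_pentSet ε).frontier_eq] at hz
  obtain ⟨hzc, hzS⟩ := hz
  obtain ⟨hzc, hle⟩ := closure_pentSet_subset hε hzc
  obtain ⟨⟨hr1, hr2⟩, hi1, hi2⟩ := (mem_closure_symRect two_pos two_pos).1 hzc
  rcases hr2.eq_or_lt with h | hr2
  · exact mem_range_of_re_eq_two hε h hi1 hi2
  rcases hr1.eq_or_lt with h | hr1
  · exact mem_range_of_re_eq_neg_two hε h.symm hi1 hi2
  have habs : |z.re| < 2 := abs_lt.2 ⟨hr1, hr2⟩
  have hlo : -2 ≤ ε * z.im := by rcases hε with rfl | rfl <;> linarith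
  rcases hlo.eq_or_lt with h | hlo
  · exact mem_range_of_im_eq (by rcases hε with rfl | rfl <;> linarith) hr1.le hr2.le
  have hzR : z ∈ symRect 2 2 :=
    mem_symRect.2 ⟨⟨hr1, hr2⟩, by rcases hε with rfl | rfl <;> constructor <;> linarith⟩
  have heq : ε * z.im = -1 / 2 + 5 / 4 * |z.re| :=
    le_antisymm hle (not_lt.1 fun h => hzS ⟨hzR, h⟩)
  rcases le_total 0 z.re with h0 | h0
  · exact mem_range_of_roof_right hε h0 hr2.le (by rw [heq, abs_of_nonneg h0])
  · exact mem_range_of_roof_left hε hr1.le h0 (by rw [heq, abs_of_nonpos h0]; ring)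

/-! ### The pentagon as a polygonal Jordan domain and as a Dobrushin domain -/

/-- **Carrier identification**: the inside of the pentagon polygon is the open pentagon (open,
bounded, nonempty, frontier on the polygon, missing the polygon). -/
theorem polygonDomain_pentVerts_carrier {ε : ℝ} (hε : ε = 1 ∨ ε = -1) :
    (polygonDomain ([⟨-2, -2 * ε⟩, ⟨2, -2 * ε⟩, ⟨2, 2 * ε⟩, ⟨0, -ε / 2⟩, ⟨-2, 2 * ε⟩] : List ℂ)
      (isSimpleClosedPolygon_pentVerts hε)).carrier = {z : ℂ | z ∈ symRect 2 2 ∧ ε * z.im < -1 / 2 + 5 / 4 * |z.re|} :=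
  polygonDomain_carrier_eq _ _ (isOpen_pentSet ε)
    ((isBounded_symRect 2 2).subset (pentSet_subset ε)) (pentSet_nonempty hε)
    (frontier_pentSet_subset hε)
    (Set.disjoint_left.2 fun _ hz hz' => notMem_pentSet_of_mem_range hε hz' hz)

/-- **MAIN EXPORT: the pentagon as a Dobrushin domain marked at `2` and `-2`** (two distinct points
of its frontier, the polygon). -/
theorem exists_pentDomain {ε : ℝ} (hε : ε = 1 ∨ ε = -1) : ∃ P : DobrushinDomain,
    P.carrier = {z : ℂ | z ∈ symRect 2 2 ∧ ε * z.im < -1 / 2 + 5 / 4 * |z.re|} ∧ P.pt 0 = 2 ∧ P.pt 1 = -2 := by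
  have hS := isSimpleClosedPolygon_pentVerts hε
  have hfr := frontier_polygonDomain_eq_range _ hS
  obtain ⟨D, hD, h0, h1, -⟩ :=
    PolygonParitySqueeze.exists_dobrushinDomain_of_frontier_points (polygonDomain _ hS) 2 (-2)
      (by rw [hfr]; exact two_mem_range hε) (by rw [hfr]; exact neg_two_mem_range hε)
      (by norm_num)
  exact ⟨D, hD.trans (polygonDomain_pentVerts_carrier hε), h0, h1⟩

/-! ### Closures -/

/-- The closure of the removed part lies in the closed square, weakly above / below the roof
(any `ε`). -/
theorem closure_diff_pentSet_subset' (ε : ℝ) : closure (symRect 2 2 \ {z : ℂ | z ∈ symRect 2 2 ∧ ε * z.im < -1 / 2 + 5 / 4 * |z.re|}) ⊆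
    {z : ℂ | z ∈ closure (symRect 2 2) ∧ -1 / 2 + 5 / 4 * |z.re| ≤ ε * z.im} :=
  closure_minimal (fun _ hz => ⟨subset_closure hz.1, not_lt.1 fun h => hz.2 ⟨hz.1, h⟩⟩)
    (isClosed_closure.inter (isClosed_le continuous_roof (continuous_const.mul continuous_im)))

/-- The closure of the removed part lies in the closed square, weakly above / below the roof. -/
theorem closure_diff_pentSet_subset {ε : ℝ} (hε : ε = 1 ∨ ε = -1) : closure (symRect 2 2 \ {z : ℂ | z ∈ symRect 2 2 ∧ ε * z.im < -1 / 2 + 5 / 4 * |z.re|}) ⊆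
    {z : ℂ | z ∈ closure (symRect 2 2) ∧ -1 / 2 + 5 / 4 * |z.re| ≤ ε * z.im} :=
  hε.elim (fun _ => closure_diff_pentSet_subset' ε) fun _ => closure_diff_pentSet_subset' ε

/-- `2` is not in the closure of the removed part (the roof is `2 > 0 = ε · im 2` there). -/
theorem two_notMem_closure_diff {ε : ℝ} (hε : ε = 1 ∨ ε = -1) :
    (2 : ℂ) ∉ closure (symRect 2 2 \ {z : ℂ | z ∈ symRect 2 2 ∧ ε * z.im < -1 / 2 + 5 / 4 * |z.re|}) :=
  fun h => by have h2 := (closure_diff_pentSet_subset hε h).2; norm_num at h2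

/-- `-2` is not in the closure of the removed part. -/
theorem neg_two_notMem_closure_diff {ε : ℝ} (hε : ε = 1 ∨ ε = -1) :
    (-2 : ℂ) ∉ closure (symRect 2 2 \ {z : ℂ | z ∈ symRect 2 2 ∧ ε * z.im < -1 / 2 + 5 / 4 * |z.re|}) :=
  fun h => by have h2 := (closure_diff_pentSet_subset hε h).2; norm_num at h2

/-! ### The boundary trace of the removed triangle: the top (ε = 1) / bottom (ε = -1) side -/

/-- The closure of the removed part meets the frontier of the square only along the side
`{im = 2ε, -2 ≤ re ≤ 2}`. -/
theorem closure_diff_inter_frontier_subset {ε : ℝ} (hε : ε = 1 ∨ ε = -1) :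
    closure (symRect 2 2 \ {z : ℂ | z ∈ symRect 2 2 ∧ ε * z.im < -1 / 2 + 5 / 4 * |z.re|}) ∩ frontier (symRect 2 2) ⊆ {z : ℂ | z.im = 2 * ε ∧ -2 ≤ z.re ∧ z.re ≤ 2} := by
  rintro z ⟨hz, hzf⟩
  have h1 : -1 / 2 + 5 / 4 * |z.re| ≤ ε * z.im := (closure_diff_pentSet_subset hε hz).2
  obtain ⟨⟨hr1, hr2⟩, hi1, hi2⟩ :=
    (mem_closure_symRect two_pos two_pos).1 (frontier_subset_closure hzf)
  refine ⟨?_, hr1, hr2⟩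
  have ha : 0 ≤ |z.re| := abs_nonneg _
  rw [mem_frontier_symRect two_pos two_pos] at hzf
  rcases hzf with ⟨-, him | him⟩ | ⟨hre | hre, -⟩
  · rcases hε with rfl | rfl <;> linarith
  · rcases hε with rfl | rfl <;> linarith
  · have : |z.re| = 2 := by rw [hre]; norm_num
    rcases hε with rfl | rfl <;> linarith
  · have : |z.re| = 2 := by rw [hre]; norm_num
    rcases hε with rfl | rfl <;> linarith

/-- The side `{im = 2ε, -2 ≤ re ≤ 2}` lies on the frontier of the square. -/
theorem topSide_subset_frontier {ε : ℝ} (hε : ε = 1 ∨ ε = -1) :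
    {z : ℂ | z.im = 2 * ε ∧ -2 ≤ z.re ∧ z.re ≤ 2} ⊆ frontier (symRect 2 2) := by
  rintro z ⟨him, hr1, hr2⟩
  rw [mem_frontier_symRect two_pos two_pos]
  rcases hε with rfl | rfl
  · exact Or.inl ⟨⟨hr1, hr2⟩, Or.inr (by linarith)⟩
  · exact Or.inl ⟨⟨hr1, hr2⟩, Or.inl (by linarith)⟩

/-- The side `{im = 2ε, -2 ≤ re ≤ 2}` is convex. -/
theorem convex_topSide (ε : ℝ) : Convex ℝ {z : ℂ | z.im = 2 * ε ∧ -2 ≤ z.re ∧ z.re ≤ 2} :=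
  (convex_hyperplane (IsLinearMap.mk add_im smul_im) _).inter
    ((convex_halfSpace_re_ge _).inter (convex_halfSpace_re_le _))

/-- The side `{im = 2ε, -2 ≤ re ≤ 2}` is preconnected (it is convex). -/
theorem isPreconnected_topSide (ε : ℝ) : IsPreconnected {z : ℂ | z.im = 2 * ε ∧ -2 ≤ z.re ∧ z.re ≤ 2} :=
  (convex_topSide ε).isPreconnected

/-- The side `{im = 2ε, -2 ≤ re ≤ 2}` is closed. -/
theorem isClosed_topSide (ε : ℝ) : IsClosed {z : ℂ | z.im = 2 * ε ∧ -2 ≤ z.re ∧ z.re ≤ 2} :=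
  (isClosed_eq continuous_im continuous_const).inter
    ((isClosed_le continuous_const continuous_re).inter
      (isClosed_le continuous_re continuous_const))

/-- `2` is not on the side `{im = 2ε, -2 ≤ re ≤ 2}`. -/
theorem two_notMem_topSide {ε : ℝ} (hε : ε = 1 ∨ ε = -1) : (2 : ℂ) ∉ {z : ℂ | z.im = 2 * ε ∧ -2 ≤ z.re ∧ z.re ≤ 2} :=
  fun h => by rcases hε with rfl | rfl <;> norm_num at h

/-- `-2` is not on the side `{im = 2ε, -2 ≤ re ≤ 2}`. -/
theorem neg_two_notMem_topSide {ε : ℝ} (hε : ε = 1 ∨ ε = -1) : (-2 : ℂ) ∉ {z : ℂ | z.im = 2 * ε ∧ -2 ≤ z.re ∧ z.re ≤ 2} :=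
  fun h => by rcases hε with rfl | rfl <;> norm_num at h

/-! ### Separation and the removed part -/

/-- **Separation**: a point in both closed pentagons has `|re| ≥ 2/5` (adding `im ≤ roof` and
`-im ≤ roof` gives `0 ≤ -1 + (5/2)|re|`). -/
theorem abs_re_ge_of_mem_closure_inter {z : ℂ}
    (h1 : z ∈ closure {z : ℂ | z ∈ symRect 2 2 ∧ (1 : ℝ) * z.im < -1 / 2 + 5 / 4 * |z.re|})
    (h2 : z ∈ closure {z : ℂ | z ∈ symRect 2 2 ∧ (-1 : ℝ) * z.im < -1 / 2 + 5 / 4 * |z.re|}) :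
    2 / 5 ≤ |z.re| := by
  have e1 := (closure_pentSet_subset' 1 h1).2
  have e2 := (closure_pentSet_subset' (-1) h2).2
  linarith

/-- A point of the square off the pentagon: the centre `0` (the roof is `-1/2 < 0` there). -/
theorem exists_mem_symRect_notMem_pentSet {ε : ℝ} (hε : ε = 1 ∨ ε = -1) :
    ∃ w : ℂ, w ∈ symRect 2 2 ∧ w ∉ {z : ℂ | z ∈ symRect 2 2 ∧ ε * z.im < -1 / 2 + 5 / 4 * |z.re|} :=
  ⟨0, zero_mem_symRect two_pos two_pos, fun h => by
    have h0 := h.2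
    rcases hε with rfl | rfl <;> norm_num at h0⟩

/-! ### Def-free export (the statement registered on the crux skeleton) -/

/-- **Registered stub `stub_pentagonWitness`** (definition-free restatement of `exists_pentDomain`, the form
registered on the skeleton of crux stmt-CriticalPhenomena-10702, line `birth`): for `ε = ±1` there is a Dobrushin domain whose carrier is
the open pentagon `{z ∈ (-2,2)² | ε · im z < -1/2 + (5/4)|re z|}`, marked at `2` and `-2`. [folklore] -/
theorem stub_pentagonWitness : ∀ ε : ℝ, (ε = 1 ∨ ε = -1) →
    ∃ P : DobrushinDomain, P.carrier = {z : ℂ | z ∈ symRect 2 2 ∧ ε * z.im < -1 / 2 + 5 / 4 * |z.re|} ∧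
      P.pt 0 = 2 ∧ P.pt 1 = -2 :=
  fun _ hε => exists_pentDomain hε

end Summit.CriticalPhenomena.SAWScalingLimit.Theorems.OneSidedPowerLaw.Negative

end
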